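import Summits.Schanuel.Schanuel.Theorems.DiophantineDichotomyApproximationPropertyBoxAvoidingLemmas
import HarnessLib

/-!
# The avoiding box principle: a small form of degree `b` outside finitely many subspaces (stub `stub_boxAvoiding`)

Crux `Summit.Schanuel.Schanuel.Theses.DiophantineDichotomy.ApproximationProperty`
(stmt-Schanuel-6117), line `orbit-interpolation-determinant`, stub `stub_boxAvoiding` of the
skeleton v17: the third hypersurface section `T` of the descent in `ℙ³` must AVOID the degree-`τ`
pieces of finitely many primes (the non-thin minimal primes of the complete-intersection curve),
each of codimension `≥ M` in `ℚ[x]_τ`. This file proves the corresponding box principle for forms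
in `m + 1` variables (`BoxAvoiding.main`): for `ω ∈ ℂᵐ`, with `c = 3 + m + log max(1, ‖ω‖)`, for
all `b`, `N ≥ 1`, `L + 4 ≤ M ≤ dim ℚ[x]_b` and every finite family `F` of `ℚ`-subspaces of
`ℚ[x₀, …, x_m]` with `#F + 1 ≤ (N+1)^L` and `dim(ℚ[x]_b ∩ W) + M ≤ dim ℚ[x]_b` (`W ∈ F`), some
form `R` of degree `b` with integer coefficients, `1 ≤ |R| ≤ N`, `h(R) ≤ log N`, lies in no
member of `F` and has `|R(1, ω)| ≤ exp(c (b + 1) − ((M − L − 4)/2) log(N + 1))`.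

Proof (template: the landed `boxPrinciple_modIdeal`, `…BoxModIdeal.lean`): let `B` be the set of
all exponents of degree `b` (`#B = dim ℚ[x]_b`, `BoxModIdeal.exists_standard_monomials` for the
zero ideal) and `φ : ℚ^B → ℚ[x]`, `p ↦ ∑ p_β x^β`, the (injective) coefficient map onto `ℚ[x]_b`;
the pull-backs `φ⁻¹(W)` (`W ∈ F`) have dimension `dim(W ∩ ℚ[x]_b) ≤ #B − M`. The avoiding box
principle `BoxAvoiding.box_principle_complex_avoiding` (pigeonhole WITH MULTIPLICITY over the
`k²` cells of the value square of `p ↦ ∑ p_β ω̄^β`, `k = (N+1)^{⌊(M−L−1)/2⌋}`,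
`k² (#F (N+1)^{#B−M} + 1) < (N+1)^{#B}` because `#F + 1 ≤ (N+1)^L` and `2⌊(M−L−1)/2⌋ + L < M`)
gives integers `p_β`, not all zero, `|p_β| ≤ N`, `(p_β) ∉ φ⁻¹(W)`, with
`|∑ p_β ω̄^β| ≤ 2(2 #B max(1,‖ω‖)^b N + 1)/k`, and `BoxAvoiding.final_bound` is the arithmetic.

The hypothesis `M ≤ dim ℚ[x]_b` is implied by the codimension hypothesis as soon as `F ≠ ∅`
(`BoxAvoiding.main_of_nonempty`); without it and with `F = ∅` the smallness exponent would be
unbounded in `M` for fixed `b, N`, which no non-zero form affords (`b = 0`: `|R(1, ω)| = |R| ≥ 1`).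

Proofs only: no definitions, no named facts. Sources: M. Waldschmidt, Invent. Math. 63 (1981) §3
(box principle); Nesterenko–Philippon (eds.), LNM 1752 (2001), Ch. 3 §4 (Def. 4.1, 4.2).
-/

set_option linter.dupNamespace false

noncomputable section

namespace Summit.Schanuel.Schanuel.Cruxes.ApproximationProperty.OrbitInterpolationDeterminant

open Literature.NumberTheory.Transcendental.Nesterenko MvPolynomial Module
open scoped BigOperators

namespace BoxAvoiding

/-- **The avoiding box principle for forms in `m + 1` variables.** For `ω ∈ ℂᵐ` there is
`c = c(ω, m) > 0` (namely `3 + m + log max(1, ‖ω‖)`) such that for all integers `b`, `N ≥ 1`,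
`L + 4 ≤ M ≤ dim ℚ[x]_b` and every finite family `F` of `ℚ`-subspaces of `ℚ[x₀, …, x_m]` with
`#F + 1 ≤ (N+1)^L`, each meeting the forms of degree `b` in codimension `≥ M`
(`dim(ℚ[x]_b ∩ W) + M ≤ dim ℚ[x]_b`), some form `R` of degree `b` with integer coefficients of
modulus `≤ N` (`1 ≤ |R| ≤ N`, `h(R) ≤ log N`) lies in NO member of `F` and has
`|R(1, ω)| ≤ exp(c (b + 1) − ((M − L − 4)/2) log(N + 1))`. [folklore] -/
theorem main (m : ℕ) (ω : Fin m → ℂ) :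
    ∃ c : ℝ, 0 < c ∧ ∀ (b N M L : ℕ) (F : Finset (Submodule ℚ (Rx m))), 1 ≤ N → L + 4 ≤ M →
      F.card + 1 ≤ (N + 1) ^ L → M ≤ finrank ℚ ↥(homogeneousSubmodule (Fin (m + 1)) ℚ b) →
      (∀ W ∈ F, finrank ℚ ↥(homogeneousSubmodule (Fin (m + 1)) ℚ b ⊓ W) + M ≤
        finrank ℚ ↥(homogeneousSubmodule (Fin (m + 1)) ℚ b)) →
      ∃ R : Rx m, (∀ W ∈ F, R ∉ W) ∧ R.IsHomogeneous b ∧ 1 ≤ maxNorm R ∧ maxNorm R ≤ N ∧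
        height R ≤ Real.log N ∧
        ‖aeval (Fin.cons 1 ω : Fin (m + 1) → ℂ) R‖ ≤
          Real.exp (c * (b + 1) - ((M : ℝ) - L - 4) / 2 * Real.log ((N : ℝ) + 1)) := by
  have hA₀ : 1 ≤ max 1 ‖ω‖ := le_max_left _ _
  have hlogA₀ : 0 ≤ Real.log (max 1 ‖ω‖) := Real.log_nonneg hA₀
  refine ⟨3 + m + Real.log (max 1 ‖ω‖), by positivity, ?_⟩
  intro b N M L F hN hLM hFL hMD hcodim
  classical
  -- the exponents `B` of degree `b`: `#B = dim ℚ[x]_b ≤ 2^{b+m}`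
  have hbot : ∀ f ∈ (⊥ : Ideal (Rx m)), ∀ d : ℕ,
      homogeneousComponent d f ∈ (⊥ : Ideal (Rx m)) := fun f hf d => by
    rw [Ideal.mem_bot] at hf ⊢
    rw [hf, map_zero]
  obtain ⟨B, hBdeg, hBcard, hBle, -⟩ := BoxModIdeal.exists_standard_monomials hbot b
  have hBD : B.card = finrank ℚ ↥(homogeneousSubmodule (Fin (m + 1)) ℚ b) := by
    rw [Submodule.restrictScalars_bot, inf_bot_eq, finrank_bot, add_zero] at hBcard
    exact hBcard
  -- the point `ω̄ = (1, ω)` and the values of the monomials at it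
  set ω' : Fin (m + 1) → ℂ := Fin.cons 1 ω with hω'def
  have hω' : ∀ i, ‖ω' i‖ ≤ max 1 ‖ω‖ := by
    refine Fin.cases ?_ ?_
    · simp [hω'def]
    · intro i
      rw [hω'def, Fin.cons_succ]
      exact (norm_le_pi_norm ω i).trans (le_max_right _ _)
  have hval : ∀ e : Fin (m + 1) →₀ ℕ, e.degree = b →
      ‖e.prod fun i k => ω' i ^ k‖ ≤ (max 1 ‖ω‖) ^ b := by
    intro e he
    rw [Finsupp.prod, norm_prod]
    calc ∏ i ∈ e.support, ‖ω' i ^ e i‖ ≤ ∏ i ∈ e.support, (max 1 ‖ω‖) ^ e i := by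
          refine Finset.prod_le_prod (fun i _ => norm_nonneg _) fun i _ => ?_
          rw [norm_pow]
          exact pow_le_pow_left₀ (norm_nonneg _) (hω' i) _
      _ = (max 1 ‖ω‖) ^ b := by rw [Finset.prod_pow_eq_pow_sum, ← Finsupp.degree_apply, he]
  -- the coefficient map `φ : ℚ^B → ℚ[x]`, `p ↦ ∑ p_β x^β`
  set φ : (↥B → ℚ) →ₗ[ℚ] Rx m :=
    ∑ j : ↥B, (monomial (j : Fin (m + 1) →₀ ℕ)).comp (LinearMap.proj j) with hφdef
  have hφ : ∀ p : ↥B → ℚ, φ p = ∑ j : ↥B, monomial (j : Fin (m + 1) →₀ ℕ) (p j) := by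
    intro p
    rw [hφdef, LinearMap.sum_apply]
    rfl
  have hφcoeff : ∀ (p : ↥B → ℚ) (e : Fin (m + 1) →₀ ℕ),
      (φ p).coeff e = if h : e ∈ B then p ⟨e, h⟩ else 0 := by
    intro p e
    rw [hφ, coeff_sum]
    simp only [coeff_monomial]
    split_ifs with h
    · rw [Finset.sum_eq_single (⟨e, h⟩ : ↥B)]
      · simp
      · intro j _ hj
        rw [if_neg]
        exact fun h' => hj (Subtype.ext h')
      · intro h'
        exact absurd (Finset.mem_univ _) h'
    · refine Finset.sum_eq_zero fun j _ => ?_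
      rw [if_neg]
      rintro rfl
      exact h j.2
  have hφinj : Function.Injective φ := by
    refine (injective_iff_map_eq_zero φ).mpr fun p hp => funext fun j => ?_
    have h := hφcoeff p j
    rw [hp, coeff_zero, dif_pos j.2] at h
    exact h.symm
  have hφrange : LinearMap.range φ ≤ homogeneousSubmodule (Fin (m + 1)) ℚ b := by
    rintro _ ⟨p, rfl⟩
    rw [hφ]
    exact Submodule.sum_mem _ fun j _ => isHomogeneous_monomial _ (hBdeg _ j.2)
  -- the pulled-back family `G = {φ⁻¹(W) : W ∈ F}`: dimensions `≤ #B − M`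
  set G : Finset (Submodule ℚ (↥B → ℚ)) := F.image fun W => W.comap φ with hGdef
  have hGcard : G.card ≤ F.card := Finset.card_image_le
  have hG : ∀ V ∈ G, finrank ℚ V ≤ B.card - M := by
    intro V hV
    obtain ⟨W, hW, rfl⟩ := Finset.mem_image.mp hV
    haveI : Module.Finite ℚ ↥(homogeneousSubmodule (Fin (m + 1)) ℚ b) :=
      Module.Finite.iff_fg.mpr (homogeneousSubmodule_fg _ _ _)
    have h1 : finrank ℚ ↥(W.comap φ) = finrank ℚ ↥((W.comap φ).map φ) :=
      (Submodule.equivMapOfInjective φ hφinj _).finrank_eq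
    have h2 : (W.comap φ).map φ ≤ homogeneousSubmodule (Fin (m + 1)) ℚ b ⊓ W := by
      rw [Submodule.map_comap_eq]
      exact inf_le_inf_right _ hφrange
    have h3 : finrank ℚ ↥((W.comap φ).map φ) ≤
        finrank ℚ ↥(homogeneousSubmodule (Fin (m + 1)) ℚ b ⊓ W) := Submodule.finrank_mono h2
    have h4 := hcodim W hW
    show finrank ℚ ↥(W.comap φ) ≤ B.card - M
    omega
  -- the count: `k² (#G (N+1)^{#B−M} + 1) < (N+1)^{#B}`
  obtain ⟨E, hE⟩ : ∃ E : ℕ, E = (M - L - 1) / 2 := ⟨_, rfl⟩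
  obtain ⟨k, hk⟩ : ∃ k : ℕ, k = (N + 1) ^ E := ⟨_, rfl⟩
  have hk0 : 0 < k := by rw [hk]; positivity
  have hMB : M ≤ B.card := hBD ▸ hMD
  have hlt : k ^ 2 * (G.card * (N + 1) ^ (B.card - M) + 1) < (N + 1) ^ Fintype.card ↥B := by
    have h2E : 2 * E + L + 1 ≤ M := by
      have := Nat.mul_div_le (M - L - 1) 2
      omega
    have hX : 1 ≤ (N + 1) ^ (B.card - M) := Nat.one_le_pow _ _ (Nat.succ_pos N)
    have hG1 : G.card + 1 ≤ (N + 1) ^ L := le_trans (by omega) hFL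
    calc k ^ 2 * (G.card * (N + 1) ^ (B.card - M) + 1)
        ≤ (N + 1) ^ (2 * E) * ((G.card + 1) * (N + 1) ^ (B.card - M)) := by
          rw [hk, ← pow_mul, mul_comm E 2, add_mul, one_mul]
          exact Nat.mul_le_mul_left _ (Nat.add_le_add_left hX _)
      _ ≤ (N + 1) ^ (2 * E) * ((N + 1) ^ L * (N + 1) ^ (B.card - M)) :=
          Nat.mul_le_mul_left _ (Nat.mul_le_mul_right _ hG1)
      _ = (N + 1) ^ (2 * E + L + (B.card - M)) := by rw [pow_add, pow_add, mul_assoc]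
      _ < (N + 1) ^ Fintype.card ↥B := by
          rw [Fintype.card_coe]
          exact Nat.pow_lt_pow_right (by omega) (by omega)
  obtain ⟨p, hp0, hpN, hpG, hpsmall⟩ := box_principle_complex_avoiding
    (fun j : ↥B => (j : Fin (m + 1) →₀ ℕ).prod fun i k => ω' i ^ k)
    (A := (max 1 ‖ω‖) ^ b) (by positivity) (fun j => hval j (hBdeg j j.2)) N k (B.card - M) hk0
    G hG hlt
  -- the form `R = ∑ p_β x^β`
  obtain ⟨Z, hZ⟩ : ∃ Z : MvPolynomial (Fin (m + 1)) ℤ,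
      Z = ∑ j : ↥B, monomial (j : Fin (m + 1) →₀ ℕ) (p j) := ⟨_, rfl⟩
  obtain ⟨R, hRZ⟩ : ∃ R : Rx m, R = MvPolynomial.map (Int.castRingHom ℚ) Z := ⟨_, rfl⟩
  have hR : R = ∑ j : ↥B, monomial (j : Fin (m + 1) →₀ ℕ) ((p j : ℤ) : ℚ) := by
    rw [hRZ, hZ, map_sum]
    simp only [map_monomial, eq_intCast]
  have hRφ : R = φ fun j => (p j : ℚ) := by rw [hR, hφ]
  have hcoeff : ∀ e, R.coeff e = if h : e ∈ B then ((p ⟨e, h⟩ : ℤ) : ℚ) else 0 := by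
    intro e
    rw [hRφ, hφcoeff]
  obtain ⟨j₀, hj₀⟩ := Function.ne_iff.mp hp0
  have hj₀' : p j₀ ≠ 0 := by simpa using hj₀
  have hRj₀ : R.coeff j₀ = p j₀ := by rw [hcoeff, dif_pos j₀.2]
  have hR0 : R ≠ 0 := by
    intro h
    rw [h, coeff_zero] at hRj₀
    exact hj₀' (by exact_mod_cast hRj₀.symm)
  have hZ0 : Z ≠ 0 := fun h => hR0 (by rw [hRZ, h, map_zero])
  have hmax1 : 1 ≤ maxNorm R := by
    refine le_trans ?_ (norm_coeff_le_maxNorm R j₀)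
    rw [hRj₀, Int.norm_cast_rat, Int.norm_eq_abs]
    exact_mod_cast Int.one_le_abs hj₀'
  have hmaxN : maxNorm R ≤ N := by
    refine CycleAPIOne.maxNorm_le_of_forall_le R (Nat.cast_nonneg N) fun e => ?_
    rw [hcoeff]
    split_ifs with h
    · rw [Int.norm_cast_rat, Int.norm_eq_abs]
      have := hpN ⟨e, h⟩
      exact_mod_cast this
    · rw [norm_zero]
      exact Nat.cast_nonneg N
  refine ⟨R, fun W hW hRW => ?_, ?_, hmax1, hmaxN, ?_, ?_⟩
  · -- `R ∉ W`: `(p_β) ∉ φ⁻¹(W) ∈ G`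
    refine hpG (W.comap φ) (Finset.mem_image_of_mem _ hW) ?_
    rw [Submodule.mem_comap, ← hRφ]
    exact hRW
  · rw [hR]
    exact IsHomogeneous.sum _ _ _ fun j _ => isHomogeneous_monomial _ (hBdeg _ j.2)
  · have hh := height_map_le_log_maxNorm Z hZ0
    rw [← hRZ] at hh
    exact hh.trans (Real.log_le_log (by linarith) hmaxN)
  · have hval_eq : aeval ω' R =
        ∑ j : ↥B, (p j : ℂ) * (j : Fin (m + 1) →₀ ℕ).prod fun i k => ω' i ^ k := by
      rw [hR, map_sum]
      refine Finset.sum_congr rfl fun j _ => ?_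
      rw [aeval_monomial, eq_ratCast, Rat.cast_intCast]
    rw [hval_eq]
    simp only [Fintype.card_coe] at hpsmall
    exact final_bound hA₀ hN hLM hMB hBle hE hk hpsmall

/-- **The avoiding box principle, non-empty family.** The variant of `BoxAvoiding.main` in which
the hypothesis `M ≤ dim ℚ[x]_b` is replaced by `F ≠ ∅` (it then follows from the codimension
hypothesis at any member of `F`). [folklore] -/
theorem main_of_nonempty (m : ℕ) (ω : Fin m → ℂ) :
    ∃ c : ℝ, 0 < c ∧ ∀ (b N M L : ℕ) (F : Finset (Submodule ℚ (Rx m))), F.Nonempty → 1 ≤ N →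
      L + 4 ≤ M → F.card + 1 ≤ (N + 1) ^ L →
      (∀ W ∈ F, finrank ℚ ↥(homogeneousSubmodule (Fin (m + 1)) ℚ b ⊓ W) + M ≤
        finrank ℚ ↥(homogeneousSubmodule (Fin (m + 1)) ℚ b)) →
      ∃ R : Rx m, (∀ W ∈ F, R ∉ W) ∧ R.IsHomogeneous b ∧ 1 ≤ maxNorm R ∧ maxNorm R ≤ N ∧
        height R ≤ Real.log N ∧
        ‖aeval (Fin.cons 1 ω : Fin (m + 1) → ℂ) R‖ ≤
          Real.exp (c * (b + 1) - ((M : ℝ) - L - 4) / 2 * Real.log ((N : ℝ) + 1)) := by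
  obtain ⟨c, hc, h⟩ := main m ω
  refine ⟨c, hc, fun b N M L F hF hN hLM hFL hcodim => h b N M L F hN hLM hFL ?_ hcodim⟩
  obtain ⟨W, hW⟩ := hF
  have := hcodim W hW
  omega

end BoxAvoiding

/-- **Stub `stub_boxAvoiding` — Dirichlet's box principle for forms AVOIDING finitely many
subspaces** (line `orbit-interpolation-determinant`, skeleton v17, with the hypothesis
`M ≤ dim ℚ[x]_b`): for `ω ∈ ℂᵐ` there is `c = c(m, ω) > 0` such that for all `b`, `N ≥ 1`,
`L + 4 ≤ M ≤ dim ℚ[x]_b` and every finite family `F` of `ℚ`-subspaces of `ℚ[x₀, …, x_m]` with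
`#F + 1 ≤ (N+1)^L`, each meeting the forms of degree `b` in codimension `≥ M`, some form `R` of
degree `b` with integer coefficients of modulus `≤ N` (`1 ≤ |R| ≤ N`, `h(R) ≤ log N`) lies in NO
member of `F` and has `|R(1, ω)| ≤ exp(c (b + 1) − ((M − L − 4)/2) log(N + 1))`
(`BoxAvoiding.main`, uncurried). [folklore] -/
theorem stub_boxAvoiding : ∀ (m : ℕ) (ω : Fin m → ℂ), ∃ c : ℝ, 0 < c ∧ ∀ (b N M L : ℕ) (F : Finset (Submodule ℚ (Rx m))), 1 ≤ N → L + 4 ≤ M → F.card + 1 ≤ (N + 1) ^ L → M ≤ Module.finrank ℚ ↥(homogeneousSubmodule (Fin (m + 1)) ℚ b) → (∀ W ∈ F, Module.finrank ℚ ↥(homogeneousSubmodule (Fin (m + 1)) ℚ b ⊓ W) + M ≤ Module.finrank ℚ ↥(homogeneousSubmodule (Fin (m + 1)) ℚ b)) → ∃ R : Rx m, (∀ W ∈ F, R ∉ W) ∧ R.IsHomogeneous b ∧ 1 ≤ maxNorm R ∧ maxNorm R ≤ N ∧ height R ≤ Real.log N ∧ ‖aeval (Fin.cons 1 ω : Fin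 (m + 1) → ℂ) R‖ ≤ Real.exp (c * (b + 1) - ((M : ℝ) - L - 4) / 2 * Real.log ((N : ℝ) + 1)) :=
  fun m ω => BoxAvoiding.main m ω

end Summit.Schanuel.Schanuel.Cruxes.ApproximationProperty.OrbitInterpolationDeterminant

end
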